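import Mathlib.Analysis.Calculus.LagrangeMultipliers
import HarnessLib

/-!
# S2β · THE ABSTRACT LAGRANGE DOOR FOR CRIT-m♮ — «a local extremum of `φ` on a level set `{f = f x₀}` of a STRICTLY differentiable SUBMERSION has `φ′ = λ ∘ f′`»
# (Mathlib's Lagrange-multiplier theorem with the degenerate multiplier excluded by surjectivity), plus the plain-function ∕ fibre-constancy ∕ kernel corollaries in
# the letter's shape, the level-set ↦ superset transfer, and the chart pull-back

Cell `ym3-torus` (YM ladder rung R3 = continuum `SU(2)` Yang–Mills on the three-torus at fixed lattice data — a RUNG: NOT d = 4, NOT infinite volume, NOT a mass gap,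
NOT Clay).  Width seat `ym3-torus-px5` (gen 22), pen (α) of the CRIT-m♮ split announced 12:13:26Z (holder px16 g21 12:11:53Z); crux `stmt-QuantumFields-20520`
(`…Theses.UnitScaleTilt.FluctuationComparisonRegPrIntL`), LINE g18-1 S2β, organ GAP♯∘ (registered `stub_uniformFibreGapOrbit`, registry UNTOUCHED) ⟸ (D♮) ∧ (F♮) ⟸ … ⟸
«MULT♭» = CRIT-m♮ ∧ MULT♮ ∧ AVG₂♭ (px16 g21 (5) `…S2BetaCritPairOfMultiplier`); `--kind proof --supports stmt-QuantumFields-20520 --as helper`, count-neutral,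
DEFINITION-FREE (0 `def`, 0 `instance`, 0 `notation`, 0 `sorry`, default heartbeats).  GENERIC: real Banach spaces `E`, `F`; nothing lattice-specific.

WHY.  CRIT-m♮ reads «`∃ DM λ, ∀ ζ, DA(U₀) ζ = λ (DM ζ)`» with `DA(U₀)` the differential of the Wilson action at the argmin `U₀` in the right-invariant chart (✓p822511
`tangentSplit`) and `DM` the differential of the charted descent.  This is the Lagrange-multiplier theorem for `φ := A ∘ chart` on the level set of `f := ` (coarse chart)
`∘ D_{J,K} ∘ chart` at `0`, PROVIDED the degenerate case `Λ₀ = 0` of Mathlib's conclusion `(Λ, Λ₀) ≠ 0 ∧ Λ ∘ f′ + Λ₀•φ′ = 0` is excluded — which is exactly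
SURJECTIVITY of `f′` (the descent is a submersion at small fields).  This file isolates that step once, abstractly, so that CRIT-m♮ ⟸ {this door, (β) ✓`…S2BetaArgminLocalMinOnFibre`
(the argmin is a local minimum of `A` on the whole fibre), (SUBM-m) (strict differentiability + surjectivity of the charted `m`-fold descent), (A-C¹) (strict differentiability
of `A ∘ chart`)} with one holder per input.

WHAT IS PROVED (sorry-free; `E F` complete real normed spaces).
* §1 ★★★`exists_dual_eq_comp_of_isLocalExtrOn` — `IsLocalExtrOn φ {x | f x = f x₀} x₀`, `HasStrictFDerivAt f f′ x₀`, `HasStrictFDerivAt φ φ′ x₀`, `f′` surjective ⟹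
  `∃ lam : Module.Dual ℝ F, ∀ x, φ′ x = lam (f′ x)`; `…_of_isLocalMinOn` ∕ `…_of_isLocalMaxOn` editions; ★`exists_fun_eq_comp_of_isLocalMinOn` (plain functions: `∃ lam : F → ℝ,
  ∀ x, φ′ x = lam (f′ x)` — CRIT-m♮'s literal shape); ★`apply_eq_apply_of_isLocalMinOn` (FIBRE-CONSTANCY «`f′ x = f′ y → φ′ x = φ′ y`» — px16 g21 (5) §2's hypothesis shape);
  ★`apply_eq_zero_of_isLocalMinOn` (KERNEL form «`f′ x = 0 → φ′ x = 0`»).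
* §2 TRANSFER [folklore]: ★`isLocalMinOn_levelSet_of_inter_nhds_subset` (a local minimum on `S` is one on the level set when `{f = f x₀} ∩ N ⊆ S` for some `N ∈ 𝓝 x₀`);
  ★`isLocalMinOn_comp_preimage` (pull-back along a map continuous at the base point within the preimage: `IsLocalMinOn φ S (g b)` ⟹ `IsLocalMinOn (φ ∘ g) (g ⁻¹' S) b`).

HONEST.  Mathlib's `IsLocalExtrOn.exists_linear_map_of_hasStrictFDerivAt` + linear algebra + filter bookkeeping [folklore]; nothing of Bałaban's analysis; CRIT-m♮, MULT♮, AVG₂♭,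
RINV, (SUBM-m), (A-C¹), «CRIT♮», (D♮)∕(F♮), GAP♯∘, the five REGISTERED stubs, S2β, crux 20520, 19936, 19200 and `YM3TorusSU2` are NOT proved; no summit statement is proved by
a helper; rung R3 = SU(2) YM₃ on T³ at fixed lattice data — NOT d = 4, NOT infinite volume, NOT a mass gap, NOT Clay; the Yang–Mills mass gap is NOT proved.  [folklore].

References: Mathlib `Analysis.Calculus.LagrangeMultipliers`; T. Bałaban, CMP **102** (1985) 277–309 [Balaban1985Variational] ((26) p.284, (171) p.305: criticality of the background
under the average constraint — the printed instance of this door); CMP **102** (1985) 255–275 [Balaban1985UV3] (p.260 «has a minimum at A = 0 … a linear term in its expansion vanishes»).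
-/

set_option autoImplicit false

namespace Summit.QuantumFields.YangMills.Theorems.FluctuationComparisonRegPrIntLS2BetaMultiplierFormOfLocalMin

open Filter Set Topology

/-! ## §1 The multiplier form of a constrained local extremum under a submersion -/

section Multiplier

variable {E F : Type*} [NormedAddCommGroup E] [NormedSpace ℝ E] [CompleteSpace E]
  [NormedAddCommGroup F] [NormedSpace ℝ F] [CompleteSpace F] {f : E → F} {φ : E → ℝ} {x₀ : E}
  {f' : E →L[ℝ] F} {φ' : StrongDual ℝ E}

/-- ★★★ **LAGRANGE, SUBMERSION CASE**: a local extremum of `φ` on the level set `{x | f x = f x₀}`, with `f`, `φ` strictly differentiable at `x₀` and `f′` SURJECTIVE, has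
`φ′ = λ ∘ f′` for some linear functional `λ` on `F` (Mathlib's `(Λ, Λ₀) ≠ 0`, `Λ ∘ f′ + Λ₀•φ′ = 0`; surjectivity forces `Λ₀ ≠ 0`; `λ := −Λ₀⁻¹•Λ`). [folklore] -/
theorem exists_dual_eq_comp_of_isLocalExtrOn
    (hextr : IsLocalExtrOn φ {x | f x = f x₀} x₀) (hf' : HasStrictFDerivAt f f' x₀) (hφ' : HasStrictFDerivAt φ φ' x₀)
    (hsurj : Function.Surjective f') :
    ∃ lam : Module.Dual ℝ F, ∀ x, φ' x = lam (f' x) := by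
  obtain ⟨Λ, Λ₀, hne, h⟩ := hextr.exists_linear_map_of_hasStrictFDerivAt hf' hφ'
  have hΛ₀ : Λ₀ ≠ 0 := by
    intro h0
    apply hne
    have hΛ : Λ = 0 := by
      apply LinearMap.ext
      intro y
      obtain ⟨x, rfl⟩ := hsurj y
      have := h x
      rw [h0, zero_smul, add_zero] at this
      simpa using this
    rw [hΛ, h0]
    rfl
  refine ⟨-(Λ₀⁻¹ • Λ), fun x => ?_⟩
  have hx := h x
  rw [smul_eq_mul] at hx
  simp only [LinearMap.neg_apply, LinearMap.smul_apply, smul_eq_mul]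
  field_simp
  linarith

/-- ★★★ The same for a local MINIMUM on the level set. [folklore] -/
theorem exists_dual_eq_comp_of_isLocalMinOn
    (hmin : IsLocalMinOn φ {x | f x = f x₀} x₀) (hf' : HasStrictFDerivAt f f' x₀) (hφ' : HasStrictFDerivAt φ φ' x₀)
    (hsurj : Function.Surjective f') :
    ∃ lam : Module.Dual ℝ F, ∀ x, φ' x = lam (f' x) :=
  exists_dual_eq_comp_of_isLocalExtrOn hmin.isExtr hf' hφ' hsurj

/-- The same for a local MAXIMUM on the level set. [folklore] -/
theorem exists_dual_eq_comp_of_isLocalMaxOn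
    (hmax : IsLocalMaxOn φ {x | f x = f x₀} x₀) (hf' : HasStrictFDerivAt f f' x₀) (hφ' : HasStrictFDerivAt φ φ' x₀)
    (hsurj : Function.Surjective f') :
    ∃ lam : Module.Dual ℝ F, ∀ x, φ' x = lam (f' x) :=
  exists_dual_eq_comp_of_isLocalExtrOn hmax.isExtr hf' hφ' hsurj

/-- ★ **PLAIN-FUNCTION SHAPE** (CRIT-m♮'s literal form «`∃ λ, ∀ ζ, DA ζ = λ (DM ζ)`» with `DA := ⇑φ′`, `DM := ⇑f′`). [folklore] -/
theorem exists_fun_eq_comp_of_isLocalMinOn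
    (hmin : IsLocalMinOn φ {x | f x = f x₀} x₀) (hf' : HasStrictFDerivAt f f' x₀) (hφ' : HasStrictFDerivAt φ φ' x₀)
    (hsurj : Function.Surjective f') :
    ∃ lam : F → ℝ, ∀ x, φ' x = lam (f' x) := by
  obtain ⟨lam, h⟩ := exists_dual_eq_comp_of_isLocalMinOn hmin hf' hφ' hsurj
  exact ⟨lam, h⟩

/-- ★ **FIBRE-CONSTANCY SHAPE** (px16 g21 (5) §2 `multiplier_of_rightInverse`'s hypothesis «`DA` is constant on the `DM`-fibres»). [folklore] -/
theorem apply_eq_apply_of_isLocalMinOn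
    (hmin : IsLocalMinOn φ {x | f x = f x₀} x₀) (hf' : HasStrictFDerivAt f f' x₀) (hφ' : HasStrictFDerivAt φ φ' x₀)
    (hsurj : Function.Surjective f') {x y : E} (hxy : f' x = f' y) :
    φ' x = φ' y := by
  obtain ⟨lam, h⟩ := exists_dual_eq_comp_of_isLocalMinOn hmin hf' hφ' hsurj
  rw [h x, h y, hxy]

/-- ★ **KERNEL SHAPE** («`ker DM ≤ ker DA`»: the first variation vanishes along every tangent of the fibre). [folklore] -/
theorem apply_eq_zero_of_isLocalMinOn
    (hmin : IsLocalMinOn φ {x | f x = f x₀} x₀) (hf' : HasStrictFDerivAt f f' x₀) (hφ' : HasStrictFDerivAt φ φ' x₀)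
    (hsurj : Function.Surjective f') {x : E} (hx : f' x = 0) :
    φ' x = 0 := by
  obtain ⟨lam, h⟩ := exists_dual_eq_comp_of_isLocalMinOn hmin hf' hφ' hsurj
  rw [h x, hx, map_zero]

end Multiplier

/-! ## §2 Transfer lemmas: from a local minimum on a bigger set to the level set; pull-back along a chart -/

section Transfer

variable {X Y : Type*} [TopologicalSpace X] [TopologicalSpace Y]

/-- ★ **LEVEL SET ↦ SUPERSET**: if `φ` has a local minimum at `x₀` on `S`, and near `x₀` the level set `{x | f x = f x₀}` lies inside `S` (`{f = f x₀} ∩ N ⊆ S` for some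
`N ∈ 𝓝 x₀`), then `φ` has a local minimum at `x₀` on the level set — the way (β)'s «local minimum on the fibre» meets §1 after charting (the charted level set is the charted
fibre near the base point). [folklore] -/
theorem isLocalMinOn_levelSet_of_inter_nhds_subset {Z : Type*} {φ : X → ℝ} {f : X → Z} {x₀ : X} {S N : Set X}
    (h : IsLocalMinOn φ S x₀) (hN : N ∈ 𝓝 x₀) (hsub : {x | f x = f x₀} ∩ N ⊆ S) :
    IsLocalMinOn φ {x | f x = f x₀} x₀ := by
  have hle : 𝓝[{x | f x = f x₀}] x₀ ≤ 𝓝[S] x₀ :=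
    calc 𝓝[{x | f x = f x₀}] x₀ = 𝓝[{x | f x = f x₀} ∩ N] x₀ :=
          (nhdsWithin_inter_of_mem' (mem_nhdsWithin_of_mem_nhds hN)).symm
      _ ≤ 𝓝[S] x₀ := nhdsWithin_mono _ hsub
  exact h.filter_mono hle

/-- The same for local maxima. [folklore] -/
theorem isLocalMaxOn_levelSet_of_inter_nhds_subset {Z : Type*} {φ : X → ℝ} {f : X → Z} {x₀ : X} {S N : Set X}
    (h : IsLocalMaxOn φ S x₀) (hN : N ∈ 𝓝 x₀) (hsub : {x | f x = f x₀} ∩ N ⊆ S) :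
    IsLocalMaxOn φ {x | f x = f x₀} x₀ := by
  have hle : 𝓝[{x | f x = f x₀}] x₀ ≤ 𝓝[S] x₀ :=
    calc 𝓝[{x | f x = f x₀}] x₀ = 𝓝[{x | f x = f x₀} ∩ N] x₀ :=
          (nhdsWithin_inter_of_mem' (mem_nhdsWithin_of_mem_nhds hN)).symm
      _ ≤ 𝓝[S] x₀ := nhdsWithin_mono _ hsub
  exact h.filter_mono hle

/-- ★ **PULL-BACK ALONG A CHART**: a local minimum of `φ` on `S` at `g b` pulls back to a local minimum of `φ ∘ g` on `g ⁻¹' S` at `b` whenever `g` is continuous at `b`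
within `g ⁻¹' S` (e.g. the right-invariant chart `ζ ↦ expPoint(ζ)•U₀` at `0`). [folklore] -/
theorem isLocalMinOn_comp_preimage {φ : X → ℝ} {S : Set X} {g : Y → X} {b : Y}
    (h : IsLocalMinOn φ S (g b)) (hg : ContinuousWithinAt g (g ⁻¹' S) b) :
    IsLocalMinOn (φ ∘ g) (g ⁻¹' S) b :=
  h.comp_tendsto (hg.tendsto_nhdsWithin (mapsTo_preimage g S))

/-- The explicit-neighbourhood form of a local minimum on a set, both directions (for hands that prefer `∃ N ∈ 𝓝 x₀`). [folklore] -/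
theorem isLocalMinOn_iff_exists_nhds {φ : X → ℝ} {S : Set X} {x₀ : X} :
    IsLocalMinOn φ S x₀ ↔ ∃ N ∈ 𝓝 x₀, ∀ x ∈ N, x ∈ S → φ x₀ ≤ φ x := by
  constructor
  · intro h
    have h' : ∀ᶠ x in 𝓝[S] x₀, φ x₀ ≤ φ x := h
    rw [eventually_nhdsWithin_iff] at h'
    exact ⟨{x | x ∈ S → φ x₀ ≤ φ x}, h', fun x hx hxS => hx hxS⟩
  · rintro ⟨N, hN, hle⟩
    show ∀ᶠ x in 𝓝[S] x₀, φ x₀ ≤ φ x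
    rw [eventually_nhdsWithin_iff]
    filter_upwards [hN] with x hx hxS
    exact hle x hx hxS

end Transfer

end Summit.QuantumFields.YangMills.Theorems.FluctuationComparisonRegPrIntLS2BetaMultiplierFormOfLocalMin
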